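import Summits.QuantumFields.YangMills.Theorems.FluctuationComparisonRegPrIntLLargeFieldGasEntropyCriterion
import Summits.QuantumFields.YangMills.Theorems.FluctuationComparisonRegPrIntLLargeFieldGasAggregation
import HarnessLib

/-!
# (R-KNIT, generic) · FACTORISED HISTORIES WITH PER-PLAQUETTE SMALL FACTORS ⟹ THE KOTECKÝ–PREISS GAS BLOCK AND THE GAS IDENTITY OF LFG^{can}∘
# — the 𝐑-operation's output socket (R1∘-gas) displayed as hypotheses, everything after it discharged ((R3-A) aggregation + (R3-E) entropy + KPL-E)

Cell `ym3-torus` (HUMAN RULING D-0037: rung R3 = continuum `SU(2)` Yang–Mills on `T³` — NOT `d = 4`, NOT infinite volume, NOT a mass gap, NOT the Clay problem);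
seat `ymfull-r3-prover-1` (gen 0; director-ym R600-ym ∕ ★★OWNER ym3-torus RULING №57 (B): hand = the registered stub `stub_largeFieldFourPtIntCan`, registry
`Cruxes/FluctuationComparisonRegPrIntL/Lines/semiclassical_s2beta.lean` v11.4, plan document `Lines/largefield_gas.lean` v3); helper of the crux `stmt-QuantumFields-20520`
`UnitScaleTilt.FluctuationComparisonRegPrIntL` (`--supports … --as helper`, NOT a proof of it); FILE 3 of this seat's LOCATE-R (20520 evidence #56; FILE 1 =
`…LargeFieldGasEntropyCriterion` (R3-E), FILE 2 = `…LargeFieldGasAggregation` (R3-A)).  THEOREMS ONLY: 0 `def`, 0 `instance`, 0 `notation`, 0 `sorry`, default heartbeats.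

WHAT THE KNIT SAYS (generic and gauge-free: any finite bond type `B`, label type `Λ`, field type `B → G'`, window `W`).  Suppose a hand on the 𝐑-operation delivers, on the
window, (i) «full = small-history × Σ over histories of ratios» (`full U = hist U · Σ_Q r Q U` — the history partition (41) read on the window: ✓`…HistoryPartition`,
✓`…LargeFieldGasWindowCut`, divided by the all-small term), (ii) PER HISTORY the FACTORISED EXPANSION WITH HOLES `r Q U = Σ_{𝒳 compatible, Q ∈ Dec 𝒳} Π_{X∈𝒳} ζ(Q↾X, X, U)`
((R1∘-gas): [Balaban1985UV3] (43)–(47); [Balaban1989LargeFieldII] (1.29)–(1.96)) with V-local component activities, admissible sub-histories NONEMPTY, located inside their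
component, components = footprints of CONNECTED CELL FAMILIES (unions of `J`-blocks), (iii) the ENERGY bound `ζ̄(Q′, X) ≤ (Π_{l∈Q′} sf l)·e^{−μ·#cells(X)}` (per-plaquette small
factors (67)–(71) × the cluster expansion's decay in the number of blocks) with (iv) the K-UNIFORM small-factor budget `Σ_{l located in X} sf l ≤ σ₀·#cells(X)` (✓`historyCount`'s
content: small factors beat the plaquette count at every depth).  THEN the footprint-aggregated activity `w U X := Σ_{Adm Q′ X} ζ(Q′, X, U)` is a Kotecký–Preiss gas on `W` in
EXACTLY the letters of `KPGasOn` (δ-unfolded, as LFG^{can}∘ ∕ KPL-D spell them, with a caller-supplied distance `dist` and lengths `ℓ`) with PINNED SIZE `σ₀`, and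
`full U = hist U · Re Ξ_{polyInc}(w_U)` on `W` — i.e. the `∃ cst w, KPGasOn … ∧ identity` body of LFG^{can}∘ with `cst = 0`, modulo px10 g16's a.e. → canonical transfer (G5).

* §1 `size_mul_exp_le` — `σ₀·n·e^{σ₀ n}·e^{−μ n} ≤ σ₀·e^{−(μ − σ₀ − 1) n}` (`n ≤ eⁿ`).
* §2 `aggregate_majorant_decay` (`w̄ X ≤ σ₀ e^{−(μ−σ₀−1)·size X}` from energy × budget) and ★★ `exists_size_of_factorised_histories` (the `a`-block of `KPGasOn` for the
  aggregated majorant `w̄ X := Σ_{Adm Q′ X} ζ̄ Q′ X`, pinned size `σ₀`, via FILE 1 §5).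
* §3 ★★★ `kpGas_and_identity_of_factorised_histories` — the knit, for the EXPLICIT aggregate `w U X := Σ_{Adm Q′ X} ζ Q′ X U` (displayed, not hidden behind `∃ w`, so that
  consumers can add continuity ∕ measurability of `w` from those of `ζ`): hypotheses (i)–(iv) + geometry (cells of `≤ s₀` bonds, each bond in `≤ m` cells, touching graph of degrees
  `≤ Δ`, lengths `ℓ X ≤ ℓ₀·#cells(X)` on admissible footprints) + the rate condition `σ₀ s₀ + κ ℓ₀ + log m + 2 log Δ + σ₀ + 2 ≤ μ` ⟹ the `KPGasOn` block with `N := σ₀` and the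
  gas identity.  Proof = FILE 2 (`aggregate_local` ∕ `abs_aggregate_le` ∕ `aggregate_empty` ∕ `aggregate_majorant_le` ∕ `sum_ratios_eq_re_gasZ`) + §1 + FILE 1
  (`pinned_criterion_of_connected_cells_decay`) + KPL-E ✓`exists_size_of_pinned_criterion`.

HONEST — WHAT THIS IS NOT.  A knit: it PROVES NOTHING of (i)–(iv) — the factorised small-field expansion with holes for the d = 3 T³ tower and its energy bound are Bałaban's
large-field renormalisation (XL, not in print in identity form for d = 3) and remain the open content of the hand; LFG^{can}∘ ∕ `stub_largeFieldFourPtIntCan` ∕ S2β ∕ the crux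
20520 NOT proved; `YM3TorusSU2` NOT proved; finite volume ∕ conditional; the Yang–Mills mass gap (Clay) NOT proved; rung R3 = YM₃ on `T³` — NOT `d = 4`, NOT infinite
volume, NOT a mass gap.
References: [Balaban1989LargeFieldII] T. Bałaban, CMP 122 (1989): (1.90)–(1.91) p.388, (1.97) p.389, (1.98)–(1.101) p.390; [Balaban1985UV3] CMP 102 (1985): (41) p.266,
(43)–(47) pp.266–267, (67)–(71) pp.273–274; [KoteckyPreiss1986] CMP 103 (1986), Theorem p.492 (1); [Grimmett1999] §4.2 (4.24) p.81.
-/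

set_option autoImplicit false

noncomputable section

open Finset
open scoped BigOperators
open Literature.Probability.LatticeModels
open Summit.QuantumFields.YangMills.Theorems.FluctuationComparisonRegPrIntLS2BetaKPLCriterion
open Summit.QuantumFields.YangMills.Theorems.FluctuationComparisonRegPrIntLLargeFieldGasEntropyCriterion
open Summit.QuantumFields.YangMills.Theorems.FluctuationComparisonRegPrIntLLargeFieldGasAggregation

namespace Summit.QuantumFields.YangMills.Theorems.FluctuationComparisonRegPrIntLLargeFieldGasKnit

/-! ## §1 Arithmetic of the aggregated majorant -/

/-- `σ₀·n·e^{σ₀ n}·e^{−μ n} ≤ σ₀·e^{−(μ − σ₀ − 1)·n}` for `σ₀ ≥ 0` (`n ≤ eⁿ`). [cite: Balaban1989LargeFieldII, (1.97) p.389 (bookkeeping)] -/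
theorem size_mul_exp_le {σ₀ μ n : ℝ} (hσ₀ : 0 ≤ σ₀) :
    σ₀ * n * Real.exp (σ₀ * n) * Real.exp (-(μ * n)) ≤ σ₀ * Real.exp (-((μ - σ₀ - 1) * n)) := by
  have h1 : n ≤ Real.exp n := by linarith [Real.add_one_le_exp n]
  have h2 : σ₀ * n * Real.exp (σ₀ * n) * Real.exp (-(μ * n)) ≤ σ₀ * Real.exp n * Real.exp (σ₀ * n) * Real.exp (-(μ * n)) := by
    have := mul_le_mul_of_nonneg_left h1 hσ₀
    have hpos : 0 ≤ Real.exp (σ₀ * n) * Real.exp (-(μ * n)) := by positivity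
    nlinarith
  calc σ₀ * n * Real.exp (σ₀ * n) * Real.exp (-(μ * n)) ≤ σ₀ * Real.exp n * Real.exp (σ₀ * n) * Real.exp (-(μ * n)) := h2
    _ = σ₀ * Real.exp (-((μ - σ₀ - 1) * n)) := by
        rw [mul_assoc, mul_assoc, ← Real.exp_add, ← Real.exp_add]
        congr 2
        ring

/-! ## §2 The aggregated majorant: energy × budget ⇒ exponential decay in the number of cells; then FILE 1's entropy criterion -/

variable {B : Type*} [Fintype B] [DecidableEq B] {Λ : Type*} [Fintype Λ] [DecidableEq Λ] {G' : Type*}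

omit [Fintype B] in
open Classical in
/-- **DECAY OF THE AGGREGATED MAJORANT**: admissible sub-histories nonempty and located inside their component, energy `ζ̄ Q′ X ≤ (Π_{l∈Q′} sf l)·e^{−μ·size X}` (`sf ≥ 0`), and the
budget `Σ_{π l ∈ X} sf l ≤ σ₀·size X` on admissible footprints give `w̄ X := Σ_{Adm Q′ X} ζ̄ Q′ X ≤ σ₀·e^{−(μ − σ₀ − 1)·size X}` for EVERY `X` (FILE 2 `aggregate_majorant_le` + §1).
[cite: Balaban1989LargeFieldII, (1.92)-(1.97) pp.388-389; Balaban1985UV3, (67)-(71) pp.273-274] -/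
theorem aggregate_majorant_decay (π : Λ → B) (Adm : Finset Λ → Finset B → Prop) (ζbar : Finset Λ → Finset B → ℝ) (sf : Λ → ℝ)
    (size : Finset B → ℕ) (σ₀ μ : ℝ)
    (hAdm : ∀ Q' X, Adm Q' X → Q'.Nonempty ∧ ∀ l ∈ Q', π l ∈ X)
    (hsf : ∀ l, 0 ≤ sf l) (hζ : ∀ Q' X, Adm Q' X → ζbar Q' X ≤ (∏ l ∈ Q', sf l) * Real.exp (-(μ * (size X : ℝ))))
    (hσ : ∀ X, (∃ Q', Adm Q' X) → ∑ l ∈ Finset.univ.filter (fun l => π l ∈ X), sf l ≤ σ₀ * (size X : ℝ)) (hσ₀ : 0 ≤ σ₀) (X : Finset B) :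
    ∑ Q' ∈ Finset.univ.filter (fun Q' : Finset Λ => Adm Q' X), ζbar Q' X ≤ σ₀ * Real.exp (-((μ - σ₀ - 1) * (size X : ℝ))) := by
  by_cases hX : ∃ Q', Adm Q' X
  · have h1 := aggregate_majorant_le π Adm ζbar sf (fun X => Real.exp (-(μ * (size X : ℝ)))) hsf (fun X => (Real.exp_pos _).le) hAdm hζ X
    have hS := hσ X hX
    set S : ℝ := ∑ l ∈ Finset.univ.filter (fun l => π l ∈ X), sf l with hSdef
    calc ∑ Q' ∈ Finset.univ.filter (fun Q' : Finset Λ => Adm Q' X), ζbar Q' X ≤ S * Real.exp S * Real.exp (-(μ * (size X : ℝ))) := h1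
      _ ≤ σ₀ * (size X : ℝ) * Real.exp (σ₀ * (size X : ℝ)) * Real.exp (-(μ * (size X : ℝ))) := by
          have h2 : Real.exp S ≤ Real.exp (σ₀ * (size X : ℝ)) := Real.exp_le_exp.mpr hS
          have h4 : S * Real.exp S ≤ σ₀ * (size X : ℝ) * Real.exp (σ₀ * (size X : ℝ)) :=
            mul_le_mul hS h2 (Real.exp_pos _).le (by positivity)
          exact mul_le_mul_of_nonneg_right h4 (Real.exp_pos _).le
      _ ≤ σ₀ * Real.exp (-((μ - σ₀ - 1) * (size X : ℝ))) := size_mul_exp_le hσ₀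
  · push Not at hX
    rw [Finset.filter_false_of_mem (fun Q' _ => hX Q'), Finset.sum_empty]
    positivity

open Classical in
/-- ★★ **THE `a`-BLOCK FOR THE AGGREGATED MAJORANT** (energy × budget × cell entropy): under the decay hypotheses of `aggregate_majorant_decay`, the cell geometry of FILE 1 §5
and the rate condition `σ₀ s₀ + κ ℓ₀ + log m + 2 log Δ + σ₀ + 2 ≤ μ`, there is a size function `a ≥ 0` with the Kotecký–Preiss inequality over `polyInc` for
`w̄ X := Σ_{Adm Q′ X} ζ̄ Q′ X` and pinned size `a{e} ≤ σ₀`. [cite: Balaban1989LargeFieldII, (1.97) p.389 and (1.100)-(1.101) p.390; KoteckyPreiss1986, Theorem p.492 (1)] -/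
theorem exists_size_of_factorised_histories
    {C : Type*} [Fintype C] [DecidableEq C] (H : SimpleGraph C) [DecidableRel H.Adj] {Δ : ℕ} (hΔ : ∀ c, H.degree c ≤ Δ) (h1Δ : 1 ≤ Δ)
    (cell : C → Finset B) {m s₀ : ℕ} (hm : ∀ e : B, (Finset.univ.filter fun c : C => e ∈ cell c).card ≤ m) (h1m : 1 ≤ m)
    (hs₀ : ∀ c, (cell c).card ≤ s₀) (size : Finset B → ℕ) (ℓ : Finset B → ℝ) (ℓ₀ : ℝ)
    (π : Λ → B) (Adm : Finset Λ → Finset B → Prop) (ζbar : Finset Λ → Finset B → ℝ) (sf : Λ → ℝ) (σ₀ μ κ : ℝ)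
    (hAdm : ∀ Q' X, Adm Q' X → Q'.Nonempty ∧ (∀ l ∈ Q', π l ∈ X) ∧
      ∃ F : Finset C, (H.induce (F : Set C)).Connected ∧ F.biUnion cell = X ∧ F.card = size X)
    (hℓ : ∀ X, (∃ Q', Adm Q' X) → ℓ X ≤ ℓ₀ * (size X : ℝ)) (hζ0 : ∀ Q' X, Adm Q' X → 0 ≤ ζbar Q' X)
    (hsf : ∀ l, 0 ≤ sf l) (hζ : ∀ Q' X, Adm Q' X → ζbar Q' X ≤ (∏ l ∈ Q', sf l) * Real.exp (-(μ * (size X : ℝ))))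
    (hσ : ∀ X, (∃ Q', Adm Q' X) → ∑ l ∈ Finset.univ.filter (fun l => π l ∈ X), sf l ≤ σ₀ * (size X : ℝ))
    (hσ₀ : 0 ≤ σ₀) (hκ : 0 ≤ κ)
    (hμ : σ₀ * (s₀ : ℝ) + κ * ℓ₀ + (Real.log m + 2 * Real.log Δ) + σ₀ + 2 ≤ μ) :
    ∃ a : Finset B → ℝ, (∀ X, 0 ≤ a X) ∧
      (∀ X : Finset B, ∑ X' ∈ Finset.univ.filter (fun X' => polyInc X' X),
        (∑ Q' ∈ Finset.univ.filter (fun Q' : Finset Λ => Adm Q' X'), ζbar Q' X') * Real.exp (a X' + κ * ℓ X') ≤ a X) ∧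
      (∀ e : B, a {e} ≤ σ₀) := by
  set wbar : Finset B → ℝ := fun X => ∑ Q' ∈ Finset.univ.filter (fun Q' : Finset Λ => Adm Q' X), ζbar Q' X with hwbar
  have hAdmE : ∀ Q', ¬ Adm Q' ∅ := by
    intro Q' h
    obtain ⟨⟨l, hl⟩, hin, -⟩ := hAdm Q' ∅ h
    exact Finset.notMem_empty _ (hin l hl)
  have hwbar0 : ∀ X, 0 ≤ wbar X := fun X => Finset.sum_nonneg fun Q' hQ' => hζ0 Q' X (Finset.mem_filter.mp hQ').2
  have hwbarE : wbar ∅ = 0 := aggregate_empty Adm (fun Q' => ζbar Q' ∅) hAdmE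
  have hne : ∀ X, wbar X ≠ 0 → ∃ Q', Adm Q' X := by
    intro X hX
    by_contra h
    push Not at h
    exact hX (by
      show ∑ Q' ∈ Finset.univ.filter (fun Q' : Finset Λ => Adm Q' X), ζbar Q' X = 0
      rw [Finset.filter_false_of_mem (fun Q' _ => h Q'), Finset.sum_empty])
  have hdec : ∀ X, wbar X ≤ σ₀ * Real.exp (-((μ - σ₀ - 1) * (size X : ℝ))) :=
    aggregate_majorant_decay π Adm ζbar sf size σ₀ μ (fun Q' X h => ⟨(hAdm Q' X h).1, (hAdm Q' X h).2.1⟩) hsf hζ hσ hσ₀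
  have hcrit := pinned_criterion_of_connected_cells_decay H hΔ h1Δ cell hm h1m hs₀ wbar ℓ size κ σ₀ (μ - σ₀ - 1) ℓ₀ hσ₀ hκ
    (fun X hX => by
      obtain ⟨Q', hQ'⟩ := hne X hX
      exact (hAdm Q' X hQ').2.2)
    (fun X hX => hℓ X (hne X hX)) hdec (by linarith)
  exact exists_size_of_pinned_criterion wbar ℓ κ hσ₀ hwbar0 hwbarE hcrit

/-! ## §3 The knit -/

open Classical in
/-- ★★★ **FACTORISED HISTORIES WITH PER-PLAQUETTE SMALL FACTORS ⟹ `KPGasOn` (δ-unfolded, pinned size `σ₀`) AND THE GAS IDENTITY `full = hist · Re Ξ(w)` ON THE WINDOW, for the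
EXPLICIT aggregate `w U X := Σ_{Adm Q′ X} ζ Q′ X U`.**  The hypotheses are the 𝐑-operation's output socket (R1∘-gas)+(R2) of LOCATE-R §1 — (i) `hfull`, (ii) `hr` with
`hAdm`∕`hloc`∕`hdom`, (iii) `hζ`, (iv) `hσ` — plus footprint geometry; the conclusion is the `∃ wbar a ℓ` block of LFG^{can}∘ for this `w` (order and letters of `KPGasOn`,
`N := σ₀`, caller's `dist`∕`ℓ`) and the identity with `cst = 0`.
[cite: Balaban1989LargeFieldII, (1.90)-(1.91) p.388, (1.97) p.389, (1.100)-(1.101) p.390; Balaban1985UV3, (41) p.266 and (67)-(71) pp.273-274; KoteckyPreiss1986, Theorem p.492 (1)] -/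
theorem kpGas_and_identity_of_factorised_histories
    -- footprint geometry: cells (the `J`-blocks) with a touching graph, polymers measured in cells
    {C : Type*} [Fintype C] [DecidableEq C] (H : SimpleGraph C) [DecidableRel H.Adj] {Δ : ℕ} (hΔ : ∀ c, H.degree c ≤ Δ) (h1Δ : 1 ≤ Δ)
    (cell : C → Finset B) {m s₀ : ℕ} (hm : ∀ e : B, (Finset.univ.filter fun c : C => e ∈ cell c).card ≤ m) (h1m : 1 ≤ m)
    (hs₀ : ∀ c, (cell c).card ≤ s₀) (size : Finset B → ℕ)
    (dist : B → B → ℝ) (ℓ : Finset B → ℝ) (ℓ₀ : ℝ) (hℓ0 : ∀ X, 0 ≤ ℓ X) (hdiam : ∀ X : Finset B, ∀ e ∈ X, ∀ e' ∈ X, dist e e' ≤ ℓ X)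
    -- the expansion data
    (W : Set (B → G')) (π : Λ → B) (Adm : Finset Λ → Finset B → Prop)
    (ζ : Finset Λ → Finset B → (B → G') → ℝ) (ζbar : Finset Λ → Finset B → ℝ) (sf : Λ → ℝ) (σ₀ μ κ : ℝ)
    (full hist : (B → G') → ℝ) (r : Finset Λ → (B → G') → ℝ)
    -- (ii) admissible sub-histories: nonempty, located inside the component, component = footprint of a connected cell family of `size X` cells
    (hAdm : ∀ Q' X, Adm Q' X → Q'.Nonempty ∧ (∀ l ∈ Q', π l ∈ X) ∧
      ∃ F : Finset C, (H.induce (F : Set C)).Connected ∧ F.biUnion cell = X ∧ F.card = size X)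
    (hℓ : ∀ X, (∃ Q', Adm Q' X) → ℓ X ≤ ℓ₀ * (size X : ℝ))
    -- (i) the history partition read on the window, (ii) the factorised expansion with holes per history
    (hfull : ∀ U, U ∈ W → full U = hist U * ∑ Q : Finset Λ, r Q U)
    (hr : ∀ (Q : Finset Λ) (U : B → G'), U ∈ W → r Q U =
      ∑ 𝒳 ∈ (Finset.univ : Finset (Finset B)).powerset.filter (fun 𝒳 => IsCompatible polyInc 𝒳 ∧
        (∀ l ∈ Q, ∃ X ∈ 𝒳, π l ∈ X) ∧ ∀ X ∈ 𝒳, Adm (Q.filter fun l => π l ∈ X) X),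
        ∏ X ∈ 𝒳, ζ (Q.filter fun l => π l ∈ X) X U)
    (hloc : ∀ Q' X (U U' : B → G'), Adm Q' X → (∀ e ∈ X, U e = U' e) → ζ Q' X U = ζ Q' X U')
    (hdom : ∀ Q' X U, Adm Q' X → U ∈ W → |ζ Q' X U| ≤ ζbar Q' X) (hζ0 : ∀ Q' X, Adm Q' X → 0 ≤ ζbar Q' X)
    -- (iii) energy: per-plaquette small factors × decay in the number of cells; (iv) the K-uniform small-factor budget per footprint
    (hsf : ∀ l, 0 ≤ sf l) (hζ : ∀ Q' X, Adm Q' X → ζbar Q' X ≤ (∏ l ∈ Q', sf l) * Real.exp (-(μ * (size X : ℝ))))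
    (hσ : ∀ X, (∃ Q', Adm Q' X) → ∑ l ∈ Finset.univ.filter (fun l => π l ∈ X), sf l ≤ σ₀ * (size X : ℝ))
    (hσ₀ : 0 ≤ σ₀) (hκ : 0 ≤ κ)
    (hμ : σ₀ * (s₀ : ℝ) + κ * ℓ₀ + (Real.log m + 2 * Real.log Δ) + σ₀ + 2 ≤ μ) :
    ∃ (wbar a ℓ' : Finset B → ℝ),
      (∀ U : B → G', (∑ Q' ∈ Finset.univ.filter (fun Q' : Finset Λ => Adm Q' ∅), ζ Q' ∅ U) = 0) ∧
      (∀ (X : Finset B) (U U' : B → G'), (∀ e ∈ X, U e = U' e) →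
        (∑ Q' ∈ Finset.univ.filter (fun Q' : Finset Λ => Adm Q' X), ζ Q' X U) =
          ∑ Q' ∈ Finset.univ.filter (fun Q' : Finset Λ => Adm Q' X), ζ Q' X U') ∧
      (∀ X, 0 ≤ a X) ∧ (∀ X, 0 ≤ ℓ' X) ∧
      (∀ U, U ∈ W → ∀ X, |∑ Q' ∈ Finset.univ.filter (fun Q' : Finset Λ => Adm Q' X), ζ Q' X U| ≤ wbar X) ∧
      (∀ X : Finset B, ∀ e ∈ X, ∀ e' ∈ X, dist e e' ≤ ℓ' X) ∧
      (∀ X : Finset B, ∑ X' ∈ Finset.univ.filter (fun X' => polyInc X' X), wbar X' * Real.exp (a X' + κ * ℓ' X') ≤ a X) ∧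
      (∀ e : B, a {e} ≤ σ₀) ∧
      ∀ U, U ∈ W → full U = hist U *
        (polymerPartitionFunction polyInc (fun X : Finset B =>
          (((∑ Q' ∈ Finset.univ.filter (fun Q' : Finset Λ => Adm Q' X), ζ Q' X U : ℝ) : ℝ) : ℂ)) Finset.univ).re := by
  have hπ : ∀ Q' X, Adm Q' X → ∀ l ∈ Q', π l ∈ X := fun Q' X h => (hAdm Q' X h).2.1
  have hAdmE : ∀ Q', ¬ Adm Q' ∅ := by
    intro Q' h
    obtain ⟨⟨l, hl⟩, hin, -⟩ := hAdm Q' ∅ h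
    exact Finset.notMem_empty _ (hin l hl)
  obtain ⟨a, ha, hKP, hpin⟩ := exists_size_of_factorised_histories H hΔ h1Δ cell hm h1m hs₀ size ℓ ℓ₀ π Adm ζbar sf σ₀ μ κ hAdm hℓ hζ0 hsf
    hζ hσ hσ₀ hκ hμ
  refine ⟨fun X => ∑ Q' ∈ Finset.univ.filter (fun Q' : Finset Λ => Adm Q' X), ζbar Q' X, a, ℓ,
    fun U => aggregate_empty Adm (fun Q' => ζ Q' ∅ U) hAdmE, fun X U U' hUU' => aggregate_local Adm ζ hloc X U U' hUU', ha, hℓ0,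
    fun U hU X => abs_aggregate_le Adm ζ ζbar W hdom X U hU, hdiam, hKP, hpin, fun U hU => ?_⟩
  -- the identity: history partition × factorised ratios = the gas of the aggregate
  rw [hfull U hU, sum_ratios_eq_re_gasZ π Adm (fun Q' X => ζ Q' X U) hπ (fun Q => r Q U) (fun Q => hr Q U hU)]

end Summit.QuantumFields.YangMills.Theorems.FluctuationComparisonRegPrIntLLargeFieldGasKnit

end
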